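import Literature.IUT.LogVolume.TensorPacketSemilinearTransport
import Literature.IUT.LogVolume.UnitLogWildDepth
import HarnessLib

/-!
# Base extension of a tensor packet, IV: item (X) of the G1-Θ memo at WILDLY ramified relative extensions over
# tie-free factors ([IUTchIV] Prop. 1.2; Thm. 1.10 Step (v))

abc-iut cell, prover seat abc-iut-f-167 (gen 5); joins `TensorPacketSemilinearTransport` (item (X) from the
`k_i`-semilinear trace transport MODULO the factorwise depth hypothesis «for every `z ∈ log_p(R_i^×)` some
`z' ∈ log_p(R'_i^×)` has `‖z'‖ ≥ p^{T_i}·‖z‖») with `UnitLogWildDepth` (that hypothesis PROVED with `T_i = t`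
whenever `e(k'_i) = e(k_i)·c·pᵗ` and `e(k_i)/(p−1)` is not a power of `p`). PROVED, for field embeddings
`σ_i : k_i → k'_i`, a packet morphism `φ` with `φ(ι_i(a)) = ι'_i(σ_i a)` and slot elements `g_i ∈ k_i^×`:

* **`packetLogμ_packetHull_orbit_slotUnion_le_of_tieFree`** (+ `'`, `_of_norm_eq`) —
  `log μ̄(hull(⋃_γ γ·⋃_i ι_i(g_i)·(R_I)^∼)) ≤ log μ̄'(hull'(⋃_{γ'} γ'·⋃_i ι'_i(σ_i g_i)·(R'_I)^∼))` as soon as every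
  factor is TIE-FREE (`e(k_i) ≠ pᵃ(p−1)` for all `a`) and `e(k'_i) = e(k_i)·c_i·p^{v_p([k'_i : k_i])}` for some
  `c_i ≥ 1` (i.e. the residue degree of `k'_i/σ_i k_i` is prime to `p`; the relative ramification is ARBITRARY —
  tame, or wild of any depth);
* **`packetLogμ_packetHull_orbit_slotUnion_le_of_tieFree_of_trace`** — the same with the `p`-power read off an
  integral element `y_i` of controlled trace, `‖Tr_{k'_i/k_i}(y_i)‖ ≥ p^{−T_i}`, `e(k'_i) = e(k_i)·c_i·p^{T_i}`
  (covers residue degrees divisible by `p` once such a `y_i` is supplied, e.g. from the maximal unramified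
  subextension).

With gen 3's `packetLogμ_packetHull_orbit_slotUnion_le_of_tame` (absolutely tame small side), gen 4's `_of_not_dvd`
(`p ∤ [k'_i:k_i]`) and `_of_trace_one` (relatively tame), item (X) remains OPEN only at tuples having a factor `i`
with `k'_i/k_i` WILDLY ramified over a TIE field `e(k_i) = pᵃ(p−1)` (e.g. `k_i ⊇ ℚ_p(ζ_p)`-like), or with
`p ∣ f(k'_i/k_i)` and no integral element of trace norm `≥ p^{−v_p(e(k'_i/k_i))}` supplied. HONEST SCOPE: classical
local algebra over the tree's typings of (Ind1)/(Ind2)/the hull of the disputed corpus [claim: Mochizuki2012,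
status: disputed]; nothing here takes a side on [IUTchIII] Cor. 3.12; typed ≠ proved. PROOF-ONLY file: no
definitions, no named `Prop` facts. [cite: Mochizuki2012, IUTchIV Prop. 1.2 (i)(ii) p. 10, Thm 1.10 proof Step (v) p. 27–28]
[cite: DupuyHilado2025, §4.7, §4.9, §4.12] [cite: NeukirchANT1999, Ch. II (4.8), (5.5)]
-/

noncomputable section

open Set Module
open scoped Pointwise TensorProduct

namespace Literature.IUT.LogVolume

variable (p : ℕ) [Fact p.Prime]
variable {I : Type} [Fintype I] [DecidableEq I] [Nonempty I]
variable (k : I → Type) [∀ i, NontriviallyNormedField (k i)] [∀ i, NormedAlgebra ℚ_[p] (k i)]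
  [∀ i, IsUltrametricDist (k i)] [∀ i, ProperSpace (k i)]
variable (k' : I → Type) [∀ i, NontriviallyNormedField (k' i)] [∀ i, NormedAlgebra ℚ_[p] (k' i)]
  [∀ i, IsUltrametricDist (k' i)] [∀ i, ProperSpace (k' i)]

/-- **Item (X) at wild relative extensions over tie-free factors**: if every `k_i` is tie-free
(`e(k_i) ≠ pᵃ(p−1)` for all `a`) and `e(k'_i) = e(k_i)·c_i·p^{v_p([k'_i : σ_i k_i])}` with `c_i ≥ 1`, then for
every packet morphism `φ` over the `σ_i` and slot elements `g_i ∈ k_i^×`: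
`log μ̄(hull(⋃_γ γ·⋃_i ι_i(g_i)·(R_I)^∼)) ≤ log μ̄'(hull'(⋃_{γ'} γ'·⋃_i ι'_i(σ_i g_i)·(R'_I)^∼))`
(`_of_depth_finrank` with the depth `p^{v_p([k'_i:k_i])}` supplied by `exists_mem_logUnits_pow_mul_norm_le`).
[cite: Mochizuki2012, IUTchIV Thm 1.10 proof Step (v) p. 27–28, Prop. 1.2 (i)(ii) p. 10] [cite: DupuyHilado2025, §4.7, §4.9, §4.12]
[cite: NeukirchANT1999, Ch. II (4.8), (5.5)] -/
theorem packetLogμ_packetHull_orbit_slotUnion_le_of_tieFree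
    (σ : ∀ i, k i →ₐ[ℚ_[p]] k' i)
    (htie : ∀ (i : I) (a : ℕ), absRamificationIdx p (k i) ≠ p ^ a * (p - 1))
    (c : I → ℕ) (hc : ∀ i, c i ≠ 0)
    (he' : ∀ i, absRamificationIdx p (k' i) = absRamificationIdx p (k i) *
      (c i * p ^ (letI := (σ i).toRingHom.toAlgebra; Module.finrank (k i) (k' i)).factorization p))
    (φ : PacketAlgebra p k →ₐ[ℚ_[p]] PacketAlgebra p k')
    (hφ : ∀ (i : I) (a : k i), φ (iota p k i a) = iota p k' i (σ i a))
    (g : Π i, k i) (hg : ∀ i, g i ≠ 0) :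
    packetLogμ p k (packetHull p k
        (⋃ γ : indTwo p k, γ • ⋃ i, iota p k i (g i) • (normalizedPacket p k : Set (PacketAlgebra p k)))) ≤
      packetLogμ p k' (packetHull p k'
        (⋃ γ : indTwo p k', γ • ⋃ i, iota p k' i (σ i (g i)) •
          (normalizedPacket p k' : Set (PacketAlgebra p k')))) :=
  packetLogμ_packetHull_orbit_slotUnion_le_of_depth_finrank p k k' σ
    (fun i _ hz => RamificationCriterion.exists_mem_logUnits_pow_mul_norm_le p (htie i) (hc i) (he' i) hz)
    φ hφ g hg

/-- **Item (X) over tie-free factors, `σ`-only form** (`φ = ⊗σ_i` from `exists_packetAlgHom_of_algHom`).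
[cite: Mochizuki2012, IUTchIV Thm 1.10 proof Step (v) p. 27–28] -/
theorem packetLogμ_packetHull_orbit_slotUnion_le_of_tieFree'
    (σ : ∀ i, k i →ₐ[ℚ_[p]] k' i)
    (htie : ∀ (i : I) (a : ℕ), absRamificationIdx p (k i) ≠ p ^ a * (p - 1))
    (c : I → ℕ) (hc : ∀ i, c i ≠ 0)
    (he' : ∀ i, absRamificationIdx p (k' i) = absRamificationIdx p (k i) *
      (c i * p ^ (letI := (σ i).toRingHom.toAlgebra; Module.finrank (k i) (k' i)).factorization p))
    (g : Π i, k i) (hg : ∀ i, g i ≠ 0) :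
    packetLogμ p k (packetHull p k
        (⋃ γ : indTwo p k, γ • ⋃ i, iota p k i (g i) • (normalizedPacket p k : Set (PacketAlgebra p k)))) ≤
      packetLogμ p k' (packetHull p k'
        (⋃ γ : indTwo p k', γ • ⋃ i, iota p k' i (σ i (g i)) •
          (normalizedPacket p k' : Set (PacketAlgebra p k')))) := by
  obtain ⟨φ, hφ⟩ := exists_packetAlgHom_of_algHom p k k' σ
  exact packetLogμ_packetHull_orbit_slotUnion_le_of_tieFree p k k' σ htie c hc he' φ hφ g hg

/-- **Item (X) over tie-free factors, norm-matched form** (big-field slots `g'_i` with `‖g'_i‖ = ‖g_i‖`).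
[cite: Mochizuki2012, IUTchIV Thm 1.10 proof Step (v) p. 27–28] -/
theorem packetLogμ_packetHull_orbit_slotUnion_le_of_tieFree_of_norm_eq
    (σ : ∀ i, k i →ₐ[ℚ_[p]] k' i)
    (htie : ∀ (i : I) (a : ℕ), absRamificationIdx p (k i) ≠ p ^ a * (p - 1))
    (c : I → ℕ) (hc : ∀ i, c i ≠ 0)
    (he' : ∀ i, absRamificationIdx p (k' i) = absRamificationIdx p (k i) *
      (c i * p ^ (letI := (σ i).toRingHom.toAlgebra; Module.finrank (k i) (k' i)).factorization p))
    (g : Π i, k i) (hg : ∀ i, g i ≠ 0) (g' : Π i, k' i) (hgg' : ∀ i, ‖g' i‖ = ‖g i‖) :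
    packetLogμ p k (packetHull p k
        (⋃ γ : indTwo p k, γ • ⋃ i, iota p k i (g i) • (normalizedPacket p k : Set (PacketAlgebra p k)))) ≤
      packetLogμ p k' (packetHull p k'
        (⋃ γ : indTwo p k', γ • ⋃ i, iota p k' i (g' i) • (normalizedPacket p k' : Set (PacketAlgebra p k')))) := by
  have hσg : ∀ i, σ i (g i) ≠ 0 := fun i => (map_ne_zero (σ i)).mpr (hg i)
  have hn' : ∀ i, ‖g' i‖ = ‖σ i (g i)‖ := fun i => by rw [hgg' i, norm_map_algHom (σ i) (g i)]
  rw [iUnion_iota_smul_normalizedPacket_eq_of_norm_eq p k' (fun i => σ i (g i)) g' hσg hn']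
  exact packetLogμ_packetHull_orbit_slotUnion_le_of_tieFree' p k k' σ htie c hc he' g hg

/-- **Item (X) over tie-free factors from an integral element of controlled trace**: if every `k_i` is
tie-free, `e(k'_i) = e(k_i)·c_i·p^{T_i}` with `c_i ≥ 1`, and every `k'_i` contains an integral `y_i` with
`‖Tr_{k'_i/σ_i k_i}(y_i)‖ ≥ p^{−T_i}` (e.g. `T_i = v_p(e(k'_i/k_i))` and `y_i` of trace `1` in the maximal
unramified subextension), then
`log μ̄(hull(⋃_γ γ·⋃_i ι_i(g_i)·(R_I)^∼)) ≤ log μ̄'(hull'(⋃_{γ'} γ'·⋃_i ι'_i(σ_i g_i)·(R'_I)^∼))`.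
[cite: Mochizuki2012, IUTchIV Thm 1.10 proof Step (v) p. 27–28, Prop. 1.2 (i)(ii) p. 10] [cite: DupuyHilado2025, §4.7, §4.9, §4.12]
[cite: NeukirchANT1999, Ch. II (4.8), (5.5)] -/
theorem packetLogμ_packetHull_orbit_slotUnion_le_of_tieFree_of_trace
    (σ : ∀ i, k i →ₐ[ℚ_[p]] k' i)
    (htie : ∀ (i : I) (a : ℕ), absRamificationIdx p (k i) ≠ p ^ a * (p - 1))
    (T c : I → ℕ) (hc : ∀ i, c i ≠ 0)
    (he' : ∀ i, absRamificationIdx p (k' i) = absRamificationIdx p (k i) * (c i * p ^ T i))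
    (htr : ∀ i, ∃ y : k' i, ‖y‖ ≤ 1 ∧
      (p : ℝ) ^ (-(T i : ℤ)) ≤ ‖(letI := (σ i).toRingHom.toAlgebra; Algebra.trace (k i) (k' i) y)‖)
    (φ : PacketAlgebra p k →ₐ[ℚ_[p]] PacketAlgebra p k')
    (hφ : ∀ (i : I) (a : k i), φ (iota p k i a) = iota p k' i (σ i a))
    (g : Π i, k i) (hg : ∀ i, g i ≠ 0) :
    packetLogμ p k (packetHull p k
        (⋃ γ : indTwo p k, γ • ⋃ i, iota p k i (g i) • (normalizedPacket p k : Set (PacketAlgebra p k)))) ≤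
      packetLogμ p k' (packetHull p k'
        (⋃ γ : indTwo p k', γ • ⋃ i, iota p k' i (σ i (g i)) •
          (normalizedPacket p k' : Set (PacketAlgebra p k')))) := by
  choose r hrlin hrΛ hrtr using fun i => exists_semilinear_logUnits_trace (p := p) (σ i)
  choose y hy1 hytr using htr
  have hw : ∀ i, (p : ℝ) ^ (-(T i : ℤ)) ≤ ‖r i (y i)‖ := fun i => by rw [hrtr i]; exact hytr i
  obtain ⟨o, ho, hoW⟩ := exists_normalizedPacket_mul_purePacket_eq_ppow p k (fun i => r i (y i)) T hw
  exact packetLogμ_packetHull_orbit_slotUnion_le_of_semilinear_of_depth p k k' φ σ hφ r hrlin hrΛ hy1 T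
    ⟨o, ho, hoW⟩
    (fun i _ hz => RamificationCriterion.exists_mem_logUnits_pow_mul_norm_le p (htie i) (hc i) (he' i) hz) g hg

end Literature.IUT.LogVolume

end
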